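import Literature.Analysis.FluidPDE.FluidComputer.ThresholdGate
import Literature.Analysis.FluidPDE.FluidComputer.ReachCertificate
import HarnessLib

/-!
# Fluid computer blueprint — the threshold gate's pre-threshold stage IS a reach certificate

HONEST FRAMING: low prior, high value-of-information experiment on Tao's machine paradigm; NOT a
claim that NS blows up. Everything in this file is finite-dimensional ODE theory about a circuit
DESIGN assembled from Tao's quadratic gates (J. Amer. Math. Soc. 29 (2016), §5); nothing is
asserted about the Euler or Navier–Stokes equations.

## What is wired here

`ReachCertificate.lean` fixes the interface through which a gate design enters the blueprint's
reach layer (`ReachCircuit`): a tube `Tube p σ` with closed graph over the cycle `[0, τc]`,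
starting at the input readout `p ∈ Ain`, inside the working region `U`, and the certificate that
every continuous curve from `p`, in `U` on `[0, σT)`, with right derivative `ε`-close to the design
field, lies in the tube and — at full cycle — has visited the output region `Aout`.

`ThresholdGate.lean` proves, for the THRESHOLD gate `thresholdCircuit ε σ ν μ r κ` (Tao's delay
circuit (5.5) plus one attenuating amplifier), the AVOID half with a budget LINEAR in seed, defect
and offsets (`IsPreThresholdCurve.mem_preTube`, `preTube_subset_preRegion`).

This file packages that AVOID half AS an inhabitant of the interface, for the PRE-THRESHOLD STAGE
of the gate's cycle: working region `preRegion a₀ R`, defect `δ`, stage length `T` (any horizon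
with positive pre-threshold margin `preMargin … T p` at every input readout), tube
`preTube … T p`, and HAND-OFF region `handoffSet … T Ain` = the ignition-ready box reached at time
`T` (from which §6 of `ThresholdGate.lean`, `IsPreThresholdCurve.ignition_time_le`, takes over).
No new analysis: the content is the bookkeeping that the interface asks for — closed graph
(`isClosed_preTube_graph`), start (`self_mem_preTube_zero`), horizon monotonicity of margin,
trigger bound and tube (`preMargin_anti`, `triggerBound_mono`, `preTube_mono`: a curve certified
over the shorter window `[0, σT]` lies in the tube computed for the full stage `[0, T]`), and the
assembly `preThresholdCertificate : ReachCertificate (thresholdCircuit …) (preRegion a₀ R) δ T Ain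
(handoffSet …)`.

## What it is NOT

It is the certificate of the FIRST of the three phases of the gate's cycle (quiet clocking up to
the threshold). The transfer phases (rotor sweep + output drain under forcing, completeness
`≥ η₀ − θ` by time `(1 + θ)·thresholdTime`) are NOT certified here or anywhere in the tree; the
blueprint records them as the open finite-dimensional item E7(b″) and supports them by numerics
only (kit job j048231). Composing stage certificates into a full-cycle `ReachCertificate` with
`Aout` = "output loaded" is therefore successor work, and so is every fluid-side statement.
[cite: Tao2016AveragedNS, §5.5 Thm 5.3 (first window); §1.3 pp. 10–11]
-/

noncomputable section

open Set Filter Topology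
open scoped NNReal

namespace Literature.Analysis.FluidPDE.FluidComputer

open Literature.Analysis.FluidPDE.Tao2016AveragedNS

variable {ε σ ν μ r κ δ a₀ R : ℝ}

/-! ### §1. Horizon monotonicity -/

/-- The pre-threshold margin `μa₀ − ν(b₀ + (εR² + δ)T)` DECREASES with the horizon `T`.
[folklore] -/
theorem preMargin_anti (hν : 0 ≤ ν) (hk : 0 ≤ ε * R ^ 2 + δ) {T' T : ℝ} (hTT : T' ≤ T)
    (X₀ : Fin 5 → ℝ) :
    preMargin ε ν μ δ a₀ R T X₀ ≤ preMargin ε ν μ δ a₀ R T' X₀ := by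
  unfold preMargin
  have h1 : (ε * R ^ 2 + δ) * T' ≤ (ε * R ^ 2 + δ) * T := mul_le_mul_of_nonneg_left hTT hk
  have h2 := mul_le_mul_of_nonneg_left h1 hν
  nlinarith [h2]

/-- The trigger bound `|c₀| + (σR² + δ)/λ_T` INCREASES with the horizon (while the margin at the
longer horizon is positive). [folklore] -/
theorem triggerBound_mono (hν : 0 ≤ ν) (hk : 0 ≤ ε * R ^ 2 + δ) (hs : 0 ≤ σ * R ^ 2 + δ)
    {T' T : ℝ} (hTT : T' ≤ T) (X₀ : Fin 5 → ℝ) (hlam : 0 < preMargin ε ν μ δ a₀ R T X₀) :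
    triggerBound ε σ ν μ δ a₀ R T' X₀ ≤ triggerBound ε σ ν μ δ a₀ R T X₀ := by
  unfold triggerBound
  have hm := preMargin_anti (μ := μ) (a₀ := a₀) hν hk hTT X₀
  have := div_le_div_of_nonneg_left hs hlam hm
  linarith

/-- **Horizon monotonicity of the tube.** At every time `t ≥ 0`, the pre-threshold tube computed
for a horizon `T' ≤ T` is contained in the one computed for `T`. [folklore] -/
theorem preTube_mono (hν : 0 ≤ ν) (hk : 0 ≤ ε * R ^ 2 + δ) (hs : 0 ≤ σ * R ^ 2 + δ)
    (hr : 0 ≤ r) (hR : 0 ≤ R) {T' T : ℝ} (hTT : T' ≤ T) (X₀ : Fin 5 → ℝ)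
    (hlam : 0 < preMargin ε ν μ δ a₀ R T X₀) {t : ℝ} (ht : 0 ≤ t) :
    preTube ε σ ν μ r δ a₀ R T' X₀ t ⊆ preTube ε σ ν μ r δ a₀ R T X₀ t := by
  intro X hX
  simp only [preTube, Set.mem_setOf_eq] at hX ⊢
  obtain ⟨h0, h1, h2, h3, h4, h5⟩ := hX
  have hC := triggerBound_mono (μ := μ) (a₀ := a₀) hν hk hs hTT X₀ hlam
  have hC0 : 0 ≤ triggerBound ε σ ν μ δ a₀ R T' X₀ := (abs_nonneg _).trans h3
  refine ⟨h0, ?_, h2, h3.trans hC, ?_, h5⟩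
  · have hsq : ν * triggerBound ε σ ν μ δ a₀ R T' X₀ ^ 2 ≤
        ν * triggerBound ε σ ν μ δ a₀ R T X₀ ^ 2 :=
      mul_le_mul_of_nonneg_left (pow_le_pow_left₀ hC0 hC 2) hν
    have := mul_le_mul_of_nonneg_right hsq ht
    nlinarith [this]
  · have hm : r * R * triggerBound ε σ ν μ δ a₀ R T' X₀ ≤
        r * R * triggerBound ε σ ν μ δ a₀ R T X₀ :=
      mul_le_mul_of_nonneg_left hC (mul_nonneg hr hR)
    have := mul_le_mul_of_nonneg_right hm ht
    nlinarith [this]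

/-! ### §2. Start and closed graph -/

/-- The initial state lies in its own tube at time `0` (carrier loaded, margin positive).
[folklore] -/
theorem self_mem_preTube_zero {T : ℝ} (X₀ : Fin 5 → ℝ) (ha : a₀ ≤ X₀ 0)
    (hs : 0 ≤ σ * R ^ 2 + δ) (hlam : 0 < preMargin ε ν μ δ a₀ R T X₀) :
    X₀ ∈ preTube ε σ ν μ r δ a₀ R T X₀ 0 := by
  simp only [preTube, Set.mem_setOf_eq, mul_zero, sub_zero, add_zero, sub_self, abs_zero]
  refine ⟨ha, le_rfl, le_rfl, ?_, le_rfl, le_rfl⟩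
  unfold triggerBound
  have := div_nonneg hs hlam.le
  linarith

/-- **Closed graph.** The graph `{(t, X) : t ∈ [0,T], X ∈ preTube … X₀ t}` of the pre-threshold
tube is closed in `ℝ × (Fin 5 → ℝ)` (six closed conditions, jointly continuous in `(t, X)`).
[folklore] -/
theorem isClosed_preTube_graph (T : ℝ) (X₀ : Fin 5 → ℝ) :
    IsClosed {z : ℝ × (Fin 5 → ℝ) | z.1 ∈ Icc 0 T ∧ z.2 ∈ preTube ε σ ν μ r δ a₀ R T X₀ z.1} := by
  have hE : Continuous (energy : (Fin 5 → ℝ) → ℝ) := by unfold energy; fun_prop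
  have hX : ∀ i : Fin 5, Continuous fun z : ℝ × (Fin 5 → ℝ) => z.2 i :=
    fun i => (continuous_apply i).comp continuous_snd
  have hEz : Continuous fun z : ℝ × (Fin 5 → ℝ) => energy z.2 := hE.comp continuous_snd
  have h0 := hX 0; have h1 := hX 1; have h2 := hX 2; have h3 := hX 3; have h4 := hX 4
  simp only [preTube, Set.mem_Icc, Set.setOf_and]
  refine ((isClosed_le continuous_const continuous_fst).inter
    (isClosed_le continuous_fst continuous_const)).inter
    ((isClosed_le continuous_const h0).inter
    ((isClosed_le (by fun_prop) h1).inter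
    ((isClosed_le h1 (by fun_prop)).inter
    ((isClosed_le (by fun_prop) continuous_const).inter
    ((isClosed_le (by fun_prop) (by fun_prop)).inter
    (isClosed_le (by fun_prop) (by fun_prop)))))))

/-- **Closed slices.** Each time slice `preTube … X₀ t` is closed. [folklore] -/
theorem isClosed_preTube (T t : ℝ) (X₀ : Fin 5 → ℝ) :
    IsClosed (preTube ε σ ν μ r δ a₀ R T X₀ t) := by
  have hE : Continuous (energy : (Fin 5 → ℝ) → ℝ) := by unfold energy; fun_prop
  have hX : ∀ i : Fin 5, Continuous fun X : Fin 5 → ℝ => X i := fun i => continuous_apply i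
  have h0 := hX 0; have h1 := hX 1; have h2 := hX 2; have h3 := hX 3; have h4 := hX 4
  simp only [preTube, Set.setOf_and]
  refine (isClosed_le continuous_const h0).inter
    ((isClosed_le continuous_const h1).inter
    ((isClosed_le h1 continuous_const).inter
    ((isClosed_le (by fun_prop) continuous_const).inter
    ((isClosed_le (by fun_prop) continuous_const).inter
    (isClosed_le (by fun_prop) continuous_const)))))

/-- **A priori bound in the tube**: the energy budget bounds every coordinate, so a state of
`preTube … X₀ t` has sup-norm at most `√(energy X₀ + 10δR·t)`. [folklore] -/
theorem norm_le_of_mem_preTube {T t : ℝ} {X₀ X : Fin 5 → ℝ}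
    (hX : X ∈ preTube ε σ ν μ r δ a₀ R T X₀ t) :
    ‖X‖ ≤ Real.sqrt (energy X₀ + 10 * (δ * R) * t) := by
  simp only [preTube, Set.mem_setOf_eq] at hX
  have h5 := hX.2.2.2.2.2
  have hEX : energy X ≤ energy X₀ + 10 * (δ * R) * t := by
    have := (abs_le.mp h5).2
    linarith
  refine (pi_norm_le_iff_of_nonneg (Real.sqrt_nonneg _)).mpr fun i => ?_
  rw [Real.norm_eq_abs]
  calc |X i| = Real.sqrt (X i ^ 2) := by rw [Real.sqrt_sq_eq_abs]
    _ ≤ Real.sqrt (energy X) := Real.sqrt_le_sqrt (sq_apply_le_energy X i)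
    _ ≤ Real.sqrt (energy X₀ + 10 * (δ * R) * t) := Real.sqrt_le_sqrt hEX

/-- **Compact slices** (closed and bounded in `Fin 5 → ℝ`): the hand-off tubes are compact, which
is what composing this stage certificate with a later stage asks for
(`CertificateComposition.lean`, `ReachCertificate.comp`). [folklore] -/
theorem isCompact_preTube (T t : ℝ) (X₀ : Fin 5 → ℝ) :
    IsCompact (preTube ε σ ν μ r δ a₀ R T X₀ t) :=
  (isCompact_closedBall (0 : Fin 5 → ℝ) (Real.sqrt (energy X₀ + 10 * (δ * R) * t))).of_isClosed_subset
    (isClosed_preTube T t X₀) fun _ hX => mem_closedBall_zero_iff.mpr (norm_le_of_mem_preTube hX)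

/-! ### §3. The pre-threshold stage as a `ReachCertificate` -/

/-- The **hand-off region** of the pre-threshold stage: the ignition-ready boxes `preTube … T p T`
reached at the end `T` of the stage from the input readouts `p ∈ Ain`. [folklore] -/
def handoffSet (ε σ ν μ r δ a₀ R T : ℝ) (Ain : Set (Fin 5 → ℝ)) : Set (Fin 5 → ℝ) :=
  {X | ∃ p ∈ Ain, X ∈ preTube ε σ ν μ r δ a₀ R T p T}

/-- **The pre-threshold stage of the threshold gate IS a robust reach–avoid certificate** in the
sense of the blueprint's reach layer (`ReachCertificate`): design field `thresholdCircuit`, working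
region `preRegion a₀ R`, defect level `δ`, stage length `T > 0`, any input region `Ain` of loaded
readouts (`a₀ ≤ p 0`) with positive pre-threshold margin at horizon `T` whose tubes stay in the
working region (discharge `hsub` with `preTube_subset_preRegion`), output region the hand-off set.
The tube is `preTube … T p`; `cert` is `IsPreThresholdCurve.mem_preTube` on the shorter window
transported by `preTube_mono`; REACH at full stage is tube membership at time `T`. All budgets are
LINEAR in `σ`, `δ` and the offsets — the point of the threshold design.
[cite: Tao2016AveragedNS, §5.5 Thm 5.3 (first window)] -/
def preThresholdCertificate (ε σ ν μ r κ δ a₀ R T : ℝ) (Ain : Set (Fin 5 → ℝ))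
    (hε : 0 ≤ ε) (hσ : 0 ≤ σ) (hν : 0 ≤ ν) (hμ : 0 ≤ μ) (hr : 0 ≤ r) (hδ : 0 ≤ δ) (hR : 0 ≤ R)
    (hT : 0 < T) (hAin : ∀ p ∈ Ain, a₀ ≤ p 0 ∧ 0 < preMargin ε ν μ δ a₀ R T p)
    (hsub : ∀ p ∈ Ain, ∀ t ∈ Icc 0 T, preTube ε σ ν μ r δ a₀ R T p t ⊆ preRegion a₀ R) :
    ReachCertificate (thresholdCircuit ε σ ν μ r κ) (preRegion a₀ R) δ T Ain
      (handoffSet ε σ ν μ r δ a₀ R T Ain) where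
  Tube p t := preTube ε σ ν μ r δ a₀ R T p t
  Tube_closed p _ := isClosed_preTube_graph T p
  Tube_zero p hp := self_mem_preTube_zero p (hAin p hp).1 (by positivity) (hAin p hp).2
  Tube_sub p hp t ht := hsub p hp t ht
  cert p hp σT x h0 hσT hx0 hcont hU hder := by
    have hk : 0 ≤ ε * R ^ 2 + δ := by positivity
    have hs : 0 ≤ σ * R ^ 2 + δ := by positivity
    have key : x σT ∈ preTube ε σ ν μ r δ a₀ R T p σT := by
      rcases eq_or_lt_of_le h0 with h00 | hpos
      · subst h00
        rw [hx0]
        exact self_mem_preTube_zero p (hAin p hp).1 hs (hAin p hp).2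
      · have hc : IsPreThresholdCurve ε σ ν μ r κ δ a₀ R σT x := ⟨hcont, hU, hder⟩
        have hlamT := (hAin p hp).2
        have hlam' : 0 < preMargin ε ν μ δ a₀ R σT (x 0) := by
          rw [hx0]; exact hlamT.trans_le (preMargin_anti hν hk hσT p)
        have hm := hc.mem_preTube hε hσ hν hμ hr hδ hpos hlam' σT ⟨h0, le_rfl⟩
        rw [hx0] at hm
        exact preTube_mono hν hk hs hr hR hσT p hlamT h0 hm
    refine ⟨key, fun hEq => ?_⟩
    subst hEq
    exact ⟨σT, ⟨h0, le_rfl⟩, p, hp, key⟩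

/-- The certificate's tube is the pre-threshold tube (definitional unfolding, for rewriting).
[folklore] -/
theorem preThresholdCertificate_tube (ε σ ν μ r κ δ a₀ R T : ℝ) (Ain : Set (Fin 5 → ℝ))
    (hε : 0 ≤ ε) (hσ : 0 ≤ σ) (hν : 0 ≤ ν) (hμ : 0 ≤ μ) (hr : 0 ≤ r) (hδ : 0 ≤ δ) (hR : 0 ≤ R)
    (hT : 0 < T) (hAin : ∀ p ∈ Ain, a₀ ≤ p 0 ∧ 0 < preMargin ε ν μ δ a₀ R T p)
    (hsub : ∀ p ∈ Ain, ∀ t ∈ Icc 0 T, preTube ε σ ν μ r δ a₀ R T p t ⊆ preRegion a₀ R)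
    (p : Fin 5 → ℝ) (t : ℝ) :
    (preThresholdCertificate ε σ ν μ r κ δ a₀ R T Ain hε hσ hν hμ hr hδ hR hT hAin hsub).Tube p t =
      preTube ε σ ν μ r δ a₀ R T p t := rfl

/-- The certificate's tubes — in particular the hand-off tubes at time `T` — are compact.
[folklore] -/
theorem isCompact_preThresholdCertificate_tube (ε σ ν μ r κ δ a₀ R T : ℝ) (Ain : Set (Fin 5 → ℝ))
    (hε : 0 ≤ ε) (hσ : 0 ≤ σ) (hν : 0 ≤ ν) (hμ : 0 ≤ μ) (hr : 0 ≤ r) (hδ : 0 ≤ δ) (hR : 0 ≤ R)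
    (hT : 0 < T) (hAin : ∀ p ∈ Ain, a₀ ≤ p 0 ∧ 0 < preMargin ε ν μ δ a₀ R T p)
    (hsub : ∀ p ∈ Ain, ∀ t ∈ Icc 0 T, preTube ε σ ν μ r δ a₀ R T p t ⊆ preRegion a₀ R)
    (p : Fin 5 → ℝ) (t : ℝ) :
    IsCompact
      ((preThresholdCertificate ε σ ν μ r κ δ a₀ R T Ain hε hσ hν hμ hr hδ hR hT hAin hsub).Tube p t) :=
  isCompact_preTube T t p

/-- **Hand-off feeds ignition.** Every state of the hand-off region is LOADED and QUIET with the
linear budgets of the stage: carrier `≥ a₀`, clock within `[b₀ − (νC₁² + δ)T, b₀ + (εR² + δ)T]` of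
its input readout's clock `b₀ = p 1`, trigger `|c| ≤ C₁ = triggerBound … T p`, output pair and
energy drift linearly small — exactly the data `§6` of `ThresholdGate.lean` starts from.
[folklore] -/
theorem handoffSet_subset (ε σ ν μ r δ a₀ R T : ℝ) (Ain : Set (Fin 5 → ℝ)) :
    handoffSet ε σ ν μ r δ a₀ R T Ain ⊆
      {X | a₀ ≤ X 0 ∧ ∃ p ∈ Ain, |X 2| ≤ triggerBound ε σ ν μ δ a₀ R T p ∧
        p 1 - (ν * triggerBound ε σ ν μ δ a₀ R T p ^ 2 + δ) * T ≤ X 1 ∧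
        X 1 ≤ p 1 + (ε * R ^ 2 + δ) * T ∧
        |energy X - energy p| ≤ 10 * (δ * R) * T} := by
  rintro X ⟨p, hp, hX⟩
  simp only [preTube, Set.mem_setOf_eq] at hX
  obtain ⟨h0, h1, h2, h3, -, h5⟩ := hX
  exact ⟨h0, p, hp, h3, h1, h2, h5⟩

end Literature.Analysis.FluidPDE.FluidComputer

end
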